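import Mathlib
import Summits.Ventures.PercRepro2.LocRows
import Summits.Ventures.PercRepro2.SwRow
import Summits.Ventures.PercRepro2.SwOut
import Summits.Ventures.PercRepro2.SwAllRow
import Summits.Ventures.PercRepro2.SwOutAll
import Summits.Ventures.PercRepro2.SwOutArmFlip
import Summits.Ventures.PercRepro2.SwOutArmThm
import Summits.Ventures.PercRepro2.SwOutCoreDefs
import Summits.Ventures.PercRepro2.SwOutBigBlockDefs

/-!
# The mixed base: vocabulary and the realisation of the raw cube (blind cell PercRepro2, night-4
g17, 2026-08-27; proofs/NIGHT4-G17.md §4″–§4⁗)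

The geometric side of the big block of a mixed single junction with a single-vertex dropped piece.
A `MixedBase` is a base configuration `σ` around `h`, the junction `u` and the dropped vertex `p`
with the u-ARMS `U j` (each joined to `u`, each red-connected to `h` inside itself), the h-PIECE `Ah`
of the mixed arm (red-connected to `h` inside itself, joined to `p` by the DEAD edges, not joined to
`u`), and the FAR arms `F k` (red-connected to `h`, joined to neither `u` nor `p`); at `σ` every edge
at `h` and at `u` is red, the dead edges and the outside edges of `p` are blue, and every edge from
an arm to the outside is blue.  The EDGE CLASSES are the edges touching `U j`, touching `Ah` (the dead
edges included), the u–p edges, the outside edges of `p` and the edges touching `F k`; a point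
`q = (s, a, uP, e, f)` of the raw cube `Pt ι κ` (SwOutBigBlockDefs) is realised by flipping the
classes whose coordinate is `false` (`mixedReal`).  This file: the classes, the realisation, the
structure and its first consequences (no loops, which vertices an edge of each class can join);
the disjointness of the classes and the value of the realisation on each class are in
`SwOutMixedBaseClasses`.
-/

namespace Summit.Ventures.PercRepro2

namespace BigBlock

open Hull LocRows

variable {V : Type*} {E : Type*}

open scoped Classical

variable (ends : E → Sym2 V)

section Classes

variable (h u p : V) {ι κ : Type*} (U : ι → Set V) (Ah : Set V) (F : κ → Set V)

/-- The union of all arms. -/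
def armsAll : Set V := (⋃ j, U j) ∪ Ah ∪ ⋃ k, F k

/-- The u–p edges. -/
def clsUP : Set E := {e | ends e = s(u, p)}

/-- The outside edges of `p`: the edges at `p` not going to `u` or into `Ah`. -/
def clsExt : Set E := {e | ∃ x, ends e = s(p, x) ∧ x ≠ u ∧ x ∉ Ah}

/-- The edges flipped by a point of the raw cube: the classes with coordinate `false`. -/
def flipSet (q : Pt ι κ) : Set E :=
  {e | ∃ j, q.1 j = false ∧ e ∈ touches ends (U j)} ∪ {e | q.2.1 = false ∧ e ∈ touches ends Ah} ∪
    {e | q.2.2.1 = false ∧ e ∈ clsUP ends u p} ∪ {e | q.2.2.2.1 = false ∧ e ∈ clsExt ends u p Ah} ∪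
    {e | ∃ k, q.2.2.2.2 k = false ∧ e ∈ touches ends (F k)}

/-- The realisation of a point of the raw cube: the base with the flipped classes. -/
noncomputable def mixedReal (σ : Config E) (q : Pt ι κ) : Config E :=
  fun e => if e ∈ flipSet ends u p U Ah F q then !σ e else σ e

end Classes

/-- **The data of a mixed base** (see the module docstring). -/
structure MixedBase (ends : E → Sym2 V) (σ : Config E) (h u p : V) {ι κ : Type*}
    (U : ι → Set V) (Ah : Set V) (F : κ → Set V) : Prop where
  hne_hu : h ≠ u
  hne_hp : h ≠ p
  hne_up : u ≠ p
  h_notMem_U : ∀ j, h ∉ U j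
  u_notMem_U : ∀ j, u ∉ U j
  p_notMem_U : ∀ j, p ∉ U j
  h_notMem_Ah : h ∉ Ah
  u_notMem_Ah : u ∉ Ah
  p_notMem_Ah : p ∉ Ah
  h_notMem_F : ∀ k, h ∉ F k
  u_notMem_F : ∀ k, u ∉ F k
  p_notMem_F : ∀ k, p ∉ F k
  U_disj : ∀ j j', j ≠ j' → ∀ x, x ∈ U j → x ∉ U j'
  U_disj_Ah : ∀ j x, x ∈ U j → x ∉ Ah
  U_disj_F : ∀ j k x, x ∈ U j → x ∉ F k
  Ah_disj_F : ∀ k x, x ∈ Ah → x ∉ F k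
  F_disj : ∀ k k', k ≠ k' → ∀ x, x ∈ F k → x ∉ F k'
  U_nonempty : ∀ j, (U j).Nonempty
  Ah_nonempty : Ah.Nonempty
  F_nonempty : ∀ k, (F k).Nonempty
  no_cross_UU : ∀ j j', j ≠ j' → ∀ e x y, ends e = s(x, y) → x ∈ U j → y ∈ U j' → False
  no_cross_UAh : ∀ j e x y, ends e = s(x, y) → x ∈ U j → y ∈ Ah → False
  no_cross_UF : ∀ j k e x y, ends e = s(x, y) → x ∈ U j → y ∈ F k → False
  no_cross_AhF : ∀ k e x y, ends e = s(x, y) → x ∈ Ah → y ∈ F k → False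
  no_cross_FF : ∀ k k', k ≠ k' → ∀ e x y, ends e = s(x, y) → x ∈ F k → y ∈ F k' → False
  h_edges : ∀ e x, ends e = s(h, x) → (∃ j, x ∈ U j) ∨ x ∈ Ah ∨ ∃ k, x ∈ F k
  u_edges : ∀ e x, ends e = s(u, x) → (∃ j, x ∈ U j) ∨ x = p
  p_edges : ∀ e x, ends e = s(p, x) → x = u ∨ x ∈ Ah ∨ (x ≠ h ∧ x ≠ p ∧ x ∉ armsAll U Ah F)
  u_adj_U : ∀ j, ∃ e x, ends e = s(u, x) ∧ x ∈ U j
  h_red : ∀ e x, ends e = s(h, x) → σ e = true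
  u_red : ∀ e x, ends e = s(u, x) → σ e = true
  dead_blue : ∀ e x, ends e = s(p, x) → x ∈ Ah → σ e = false
  ext_blue : ∀ e x, ends e = s(p, x) → x ≠ u → x ∉ Ah → σ e = false
  bdry_blue : ∀ e x y, ends e = s(x, y) → x ∈ armsAll U Ah F → y ≠ h → y ≠ u → y ≠ p →
    y ∉ armsAll U Ah F → σ e = false
  U_conn : ∀ j, ∀ x ∈ U j, x ∈ cluster ends (insideConfig ends (U j ∪ {h}) σ) h
  Ah_conn : ∀ x ∈ Ah, x ∈ cluster ends (insideConfig ends (Ah ∪ {h}) σ) h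
  F_conn : ∀ k, ∀ x ∈ F k, x ∈ cluster ends (insideConfig ends (F k ∪ {h}) σ) h

section Base

variable {ends} {σ : Config E} {h u p : V} {ι κ : Type*} {U : ι → Set V} {Ah : Set V}
  {F : κ → Set V} (hb : MixedBase ends σ h u p U Ah F)
include hb

/-- No loop at `h`. -/
lemma MixedBase.loop_h (e : E) : ends e ≠ s(h, h) := by
  intro he
  rcases hb.h_edges e h he with ⟨j, hj⟩ | hj | ⟨k, hk⟩
  · exact hb.h_notMem_U j hj
  · exact hb.h_notMem_Ah hj
  · exact hb.h_notMem_F k hk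

/-- No loop at `u`. -/
lemma MixedBase.loop_u (e : E) : ends e ≠ s(u, u) := by
  intro he
  rcases hb.u_edges e u he with ⟨j, hj⟩ | hj
  · exact hb.u_notMem_U j hj
  · exact hb.hne_up hj

/-- No loop at `p`. -/
lemma MixedBase.loop_p (e : E) : ends e ≠ s(p, p) := by
  intro he
  rcases hb.p_edges e p he with hj | hj | ⟨_, hj, _⟩
  · exact hb.hne_up hj.symm
  · exact hb.p_notMem_Ah hj
  · exact hj rfl

/-- No edge joins `h` and `u`. -/
lemma MixedBase.no_hu (e : E) : ends e ≠ s(h, u) := by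
  intro he
  rcases hb.h_edges e u he with ⟨j, hj⟩ | hj | ⟨k, hk⟩
  · exact hb.u_notMem_U j hj
  · exact hb.u_notMem_Ah hj
  · exact hb.u_notMem_F k hk

/-- No edge joins `h` and `p`. -/
lemma MixedBase.no_hp (e : E) : ends e ≠ s(h, p) := by
  intro he
  rcases hb.h_edges e p he with ⟨j, hj⟩ | hj | ⟨k, hk⟩
  · exact hb.p_notMem_U j hj
  · exact hb.p_notMem_Ah hj
  · exact hb.p_notMem_F k hk

/-- `Ah` is not joined to `u`. -/
lemma MixedBase.no_uAh {e : E} {x : V} (he : ends e = s(u, x)) : x ∉ Ah := by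
  intro hx
  rcases hb.u_edges e x he with ⟨j, hj⟩ | rfl
  · exact hb.U_disj_Ah j x hj hx
  · exact hb.p_notMem_Ah hx

/-- `F k` is not joined to `u`. -/
lemma MixedBase.no_uF {e : E} {x : V} (he : ends e = s(u, x)) (k : κ) : x ∉ F k := by
  intro hx
  rcases hb.u_edges e x he with ⟨j, hj⟩ | rfl
  · exact hb.U_disj_F j k x hj hx
  · exact hb.p_notMem_F k hx

/-- `U j` is not joined to `p`. -/
lemma MixedBase.no_pU {e : E} {x : V} (he : ends e = s(p, x)) (j : ι) : x ∉ U j := by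
  intro hx
  rcases hb.p_edges e x he with rfl | hx' | ⟨_, _, hx'⟩
  · exact hb.u_notMem_U j hx
  · exact hb.U_disj_Ah j x hx hx'
  · exact hx' (Or.inl (Or.inl (Set.mem_iUnion.2 ⟨j, hx⟩)))

/-- `F k` is not joined to `p`. -/
lemma MixedBase.no_pF {e : E} {x : V} (he : ends e = s(p, x)) (k : κ) : x ∉ F k := by
  intro hx
  rcases hb.p_edges e x he with rfl | hx' | ⟨_, _, hx'⟩
  · exact hb.u_notMem_F k hx
  · exact hb.Ah_disj_F k x hx' hx
  · exact hx' (Or.inr (Set.mem_iUnion.2 ⟨k, hx⟩))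

/-- An edge touching `U j` has an end in `U j` and the other end in `U j`, at `h`, at `u`, or
outside everything. -/
lemma MixedBase.ends_of_touches_U {j : ι} {e : E} (he : e ∈ touches ends (U j)) :
    ∃ x y, ends e = s(x, y) ∧ x ∈ U j ∧
      (y ∈ U j ∨ y = h ∨ y = u ∨ (y ≠ h ∧ y ≠ u ∧ y ≠ p ∧ y ∉ armsAll U Ah F)) := by
  obtain ⟨x, hx, y, hxy⟩ := he
  refine ⟨x, y, hxy, hx, ?_⟩
  by_cases hyU : y ∈ U j
  · exact Or.inl hyU
  by_cases hyh : y = h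
  · exact Or.inr (Or.inl hyh)
  by_cases hyu : y = u
  · exact Or.inr (Or.inr (Or.inl hyu))
  refine Or.inr (Or.inr (Or.inr ⟨hyh, hyu, ?_, ?_⟩))
  · rintro rfl
    exact hb.no_pU (ends_swap hxy) j hx
  · rintro ((hy | hy) | hy)
    · obtain ⟨j', hj'⟩ := Set.mem_iUnion.1 hy
      have hne : j ≠ j' := by rintro rfl; exact hyU hj'
      exact hb.no_cross_UU j j' hne e x y hxy hx hj'
    · exact hb.no_cross_UAh j e x y hxy hx hy
    · obtain ⟨k, hk⟩ := Set.mem_iUnion.1 hy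
      exact hb.no_cross_UF j k e x y hxy hx hk

/-- An edge touching `Ah` has an end in `Ah` and the other end in `Ah`, at `h`, at `p` (a dead
edge), or outside everything. -/
lemma MixedBase.ends_of_touches_Ah {e : E} (he : e ∈ touches ends Ah) :
    ∃ x y, ends e = s(x, y) ∧ x ∈ Ah ∧
      (y ∈ Ah ∨ y = h ∨ y = p ∨ (y ≠ h ∧ y ≠ u ∧ y ≠ p ∧ y ∉ armsAll U Ah F)) := by
  obtain ⟨x, hx, y, hxy⟩ := he
  refine ⟨x, y, hxy, hx, ?_⟩
  by_cases hyA : y ∈ Ah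
  · exact Or.inl hyA
  by_cases hyh : y = h
  · exact Or.inr (Or.inl hyh)
  by_cases hyp : y = p
  · exact Or.inr (Or.inr (Or.inl hyp))
  refine Or.inr (Or.inr (Or.inr ⟨hyh, ?_, hyp, ?_⟩))
  · rintro rfl
    exact hb.no_uAh (ends_swap hxy) hx
  · rintro ((hy | hy) | hy)
    · obtain ⟨j, hj⟩ := Set.mem_iUnion.1 hy
      exact hb.no_cross_UAh j e y x (ends_swap hxy) hj hx
    · exact hyA hy
    · obtain ⟨k, hk⟩ := Set.mem_iUnion.1 hy
      exact hb.no_cross_AhF k e x y hxy hx hk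

/-- An edge touching `F k` has an end in `F k` and the other end in `F k`, at `h`, or outside
everything. -/
lemma MixedBase.ends_of_touches_F {k : κ} {e : E} (he : e ∈ touches ends (F k)) :
    ∃ x y, ends e = s(x, y) ∧ x ∈ F k ∧
      (y ∈ F k ∨ y = h ∨ (y ≠ h ∧ y ≠ u ∧ y ≠ p ∧ y ∉ armsAll U Ah F)) := by
  obtain ⟨x, hx, y, hxy⟩ := he
  refine ⟨x, y, hxy, hx, ?_⟩
  by_cases hyF : y ∈ F k
  · exact Or.inl hyF
  by_cases hyh : y = h
  · exact Or.inr (Or.inl hyh)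
  refine Or.inr (Or.inr ⟨hyh, ?_, ?_, ?_⟩)
  · rintro rfl
    exact hb.no_uF (ends_swap hxy) k hx
  · rintro rfl
    exact hb.no_pF (ends_swap hxy) k hx
  · rintro ((hy | hy) | hy)
    · obtain ⟨j, hj⟩ := Set.mem_iUnion.1 hy
      exact hb.no_cross_UF j k e y x (ends_swap hxy) hj hx
    · exact hb.no_cross_AhF k e y x (ends_swap hxy) hy hx
    · obtain ⟨k', hk'⟩ := Set.mem_iUnion.1 hy
      have hne : k ≠ k' := by rintro rfl; exact hyF hk'
      exact hb.no_cross_FF k k' hne e x y hxy hx hk'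

end Base

end BigBlock

end Summit.Ventures.PercRepro2
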